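import Mathlib
import Summits.ResolutionOfSingularities.ResolutionOfSingularities.Theorems.EquisingularLiftDefs
import Summits.ResolutionOfSingularities.ResolutionOfSingularities.Theorems.EquisingularLiftEquisingularLiftGoodAtOfRegularFibre
import Summits.ResolutionOfSingularities.ResolutionOfSingularities.Theorems.EquisingularLiftEquisingularLiftGoodAtOverIso
import Summits.ResolutionOfSingularities.ResolutionOfSingularities.Theorems.EquisingularLiftEquisingularLiftGoodAtOfSmooth
import Summits.ResolutionOfSingularities.ResolutionOfSingularities.Theorems.EquisingularLiftEquisingularLiftSectionBlowupFlatExceptional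
import Summits.ResolutionOfSingularities.ResolutionOfSingularities.Theorems.EquisingularLiftEquisingularLiftSectionBlowupSpecialFibre
import Summits.ResolutionOfSingularities.ResolutionOfSingularities.Theorems.EquisingularLiftEquisingularLiftSectionComapPoint
import Summits.ResolutionOfSingularities.ResolutionOfSingularities.Theorems.EquisingularLiftEquisingularLiftSectionKer
import Literature.AlgebraicGeometry.Resolution.RegularBlowup
import Literature.AlgebraicGeometry.Resolution.BlowupStalkEmbedding
import Literature.AlgebraicGeometry.Resolution.ResolutionOfCurves
import Literature.AlgebraicGeometry.Resolution.SmoothStalksRegular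
import Literature.AlgebraicGeometry.Resolution.AlterationsProofs
import HarnessLib

/-!
# Blowing up a section through a smooth point: good reduction along the exceptional fibre

Helper `goodAt_of_isBlowup_section` (sub-goal L2 of the registered stub
`stub_resolveOnePoint_dimOne`) of the line `strata-split` for the crux `EquisingularLift`
(stmt-ResolutionOfSingularities-15660).

Let `O` be a discrete valuation ring with uniformizer `ϖ` and residue field `κ`, `X'` an integral
scheme separated over `Spec O` (`r'`), `U ⊆ X'` an open which is SMOOTH over `Spec O`,
`s : Spec O → X'` a section of `r'` whose closed point `z₁ = s(𝔪)` lies in `U`, and `τ : X'' → X'`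
a blow-up of `X'` along the ideal sheaf `ker s` of the section. CLAIM: at every point `w ∈ X''`
over `z₁` the blown-up ambient has GOOD REDUCTION, `GoodAt (τ ≫ r') w`: the local ring
`𝒪_{X'',w}` is regular and the germ of `ϖ` at `w` is a regular parameter (`∉ 𝔪_w²`).

Proof. Everything is local over `U ⊇ s(Spec O)` (opens are stable under generization, so `s`
factors as `s_U : Spec O → U`, a section of the smooth separated `r_U = U ↪ X' → Spec O`, and
`ker s|_U = ker s_U`); the blow-up restricts to a blow-up `τ_U : U'' = τ⁻¹(U) → U` of `U` along
`ker s_U` (`IsBlowup.restrict`), and `GoodAt` is insensitive to the open immersion `U'' ↪ X''`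
(`stub_goodAtOverIso`). For the local statement (`goodAt_of_isBlowup_section_local`) we feed the
helper `goodAt_of_isRegularLocalRing_fibre` (regular ambient + non-zero germ of `ϖ` + regular
special fibre ⇒ good reduction):

1. `U''` is regular: `U` is regular (smooth over the regular `Spec O`, EGA IV₄ 17.5.8 (iii)) and
   locally Noetherian, the centre `V(ker s_U) ≅ Spec O` is regular, so Liu's Thm. 8.1.19 (a)
   (`IsBlowup.isRegular_of_isRegular_subscheme`) applies.
2. The germ of `ϖ` at `w` is non-zero: it is the image of the germ of `ϖ` at `z₁ ∈ U` under the
   stalk map `𝒪_{U,z₁} → 𝒪_{U'',w}`, which is injective for a blow-up of an integral locally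
   Noetherian scheme (`IsBlowup.stalkMap_injective`), and the germ at `z₁` is not even in
   `𝔪_{z₁}²` (`stub_goodAtOfSmooth`, `U` being smooth over `O`).
3. The special fibre `U'' ×_{Spec O} Spec κ ≅ U'' ×_U U_κ` is regular: the exceptional divisor is
   flat over `O` (`flat_exceptional_of_isBlowup_section`, Liu 8.1.19 (b)), so
   `U'' ×_U U_κ → U_κ` is the blow-up of the special fibre `U_κ` along `ker s_U · 𝒪_{U_κ}`
   (`isBlowup_specialFibre_of_flat_exceptional`, Stacks 0805), which is the vanishing ideal of the
   reduced closed point `z₁` of `U_κ` (`ker_section_comap_eq_vanishingIdeal`: the section meets the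
   reduced special fibre transversally); `U_κ` is regular (smooth over the field `κ`) and a reduced
   point is a regular scheme, so Liu 8.1.19 (a) applies once more.

References: Q. Liu, *Algebraic Geometry and Arithmetic Curves*, OUP 2002, Thm. 8.1.19;
A. Grothendieck, J. Dieudonné, *EGA IV₄*, Publ. Math. IHÉS 32 (1967), Prop. 17.5.8 (iii);
The Stacks Project, Tag 0805.
-/

set_option linter.dupNamespace false -- mandated namespace `Summit.<Summit>.<Problem>` of this single-conjunct summit
set_option linter.overlappingInstances false -- the registered signature carries both [IsDomain O] and [IsDiscreteValuationRing O] (Mathlib's class takes the former as a parameter)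

noncomputable section

namespace Summit.ResolutionOfSingularities.ResolutionOfSingularities.Cruxes.EquisingularLift.StrataSplit

open CategoryTheory CategoryTheory.Limits AlgebraicGeometry TopologicalSpace Topology
open IsLocalRing Literature.AlgebraicGeometry.Resolution
open Summit.ResolutionOfSingularities.ResolutionOfSingularities.Theses.EquisingularLift.Split

/-! ## Three small structural lemmas -/

/-- The restriction of the open immersion `V ↪ P` over `V` itself is an isomorphism
(a surjective open immersion). -/
theorem isIso_ι_morphismRestrict_self {P : Scheme.{0}} (V : P.Opens) : IsIso (V.ι ∣_ V) := by
  rw [isIso_iff_isOpenImmersion_and_surjective]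
  refine ⟨inferInstance, ⟨fun x => ⟨⟨x, show V.ι x ∈ V from x.2⟩, ?_⟩⟩⟩
  exact Subtype.ext (morphismRestrict_base_coe V.ι V _)

/-- **A reduced closed point is a regular closed subscheme**: the closed subscheme of `X` defined by
the vanishing ideal sheaf of a closed point `x` is an integral scheme with a single point, whose
local ring is therefore its function field, a regular local ring. -/
theorem isRegular_subscheme_vanishingIdeal_singleton {X : Scheme.{0}} (x : X)
    (hx : IsClosed ({x} : Set X)) :
    Scheme.IsRegular (Scheme.IdealSheafData.vanishingIdeal (⟨{x}, hx⟩ : Closeds X)).subscheme := by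
  haveI : IsIntegral (Scheme.IdealSheafData.vanishingIdeal (⟨{x}, hx⟩ : Closeds X)).subscheme :=
    isIntegral_subscheme_vanishingIdeal ⟨{x}, hx⟩ isIrreducible_singleton
  -- the subscheme has a single point (its inclusion is injective with range `{x}`)
  have hpt : ∀ z : ↥(Scheme.IdealSheafData.vanishingIdeal (⟨{x}, hx⟩ : Closeds X)).subscheme,
      z = genericPoint _ := fun z => by
    have h1 : ((Scheme.IdealSheafData.vanishingIdeal (⟨{x}, hx⟩ : Closeds X)).subschemeι z : X) ∈
        ({x} : Set X) := mem_of_subscheme_vanishingIdeal (⟨{x}, hx⟩ : Closeds X) z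
    have h2 : ((Scheme.IdealSheafData.vanishingIdeal (⟨{x}, hx⟩ : Closeds X)).subschemeι
        (genericPoint _) : X) ∈ ({x} : Set X) :=
      mem_of_subscheme_vanishingIdeal (⟨{x}, hx⟩ : Closeds X) (genericPoint _)
    rw [Set.mem_singleton_iff] at h1 h2
    exact (Scheme.IdealSheafData.subschemeι _).isClosedEmbedding.injective (h1.trans h2.symm)
  -- adapted from Literature/AlgebraicGeometry/Resolution/AlterationsProofs.lean
  -- (`Scheme.IsRegular.of_topologicalKrullDim_le_zero`)
  intro z
  rw [hpt z]
  change IsRegularLocalRing (Scheme.functionField _)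
  infer_instance

/-- **The ideal of a closed immersion factoring through an open.** If `s : Z → X` is quasi-compact
with image inside the open `U ⊆ X`, then the restriction to `U` of the ideal sheaf `ker s` is the
ideal sheaf `ker s_U` of the factorisation `s_U : Z → U` (the square `s_U, 𝟙, U ↪ X, s` is
cartesian). -/
theorem ker_comap_ι_eq_ker_lift {X Z : Scheme.{0}} (s : Z ⟶ X) [QuasiCompact s] (U : X.Opens)
    (h : Set.range s ⊆ Set.range U.ι) :
    s.ker.comap U.ι = (IsOpenImmersion.lift U.ι s h).ker := by
  have H : IsPullback (IsOpenImmersion.lift U.ι s h) (𝟙 Z) U.ι s :=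
    IsPullback.of_vert_isIso_mono ⟨by rw [Category.id_comp, IsOpenImmersion.lift_fac]⟩
  ext W : 2
  rw [Scheme.IdealSheafData.ideal_comap_of_isOpenImmersion,
    Scheme.ker_ideal_of_isPullback_of_isOpenImmersion s _ (𝟙 Z) U.ι H W]

/-! ## The local statement: `U` itself smooth over `Spec O` -/

/-- **The blow-up of a smooth `O`-scheme along a section has good reduction everywhere.** Let `O`
be a discrete valuation ring, `U` integral with `r_U : U → Spec O` smooth and separated, `s_U` a
section of `r_U`, `τ_U : U'' → U` a blow-up along `ker s_U`, and `w ∈ U''`. Then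
`GoodAt (τ_U ≫ r_U) w`: (1) `U''` is regular (Liu 8.1.19 (a): `U` regular locally Noetherian,
centre `≅ Spec O` regular); (2) the germ of a uniformizer `ϖ` at `w` is non-zero (image of the
germ at `τ_U w`, which lies outside `𝔪²` as `U` is smooth over `O`, under the injective stalk map
of the blow-up); (3) the special fibre of `U''` is `U'' ×_U U_κ`, the blow-up of the regular `U_κ`
in the reduced closed point `s_U(𝔪)` (the exceptional divisor being flat over `O`), hence regular.
[cite: Liu2002, Thm. 8.1.19] -/
theorem goodAt_of_isBlowup_section_local (O : Type) [CommRing O] [IsDomain O]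
    [IsDiscreteValuationRing O] (U U'' : Scheme.{0}) [IsIntegral U] (rU : U ⟶ Spec (.of O))
    [Smooth rU] [IsSeparated rU] (sU : Spec (.of O) ⟶ U) (hsec : sU ≫ rU = 𝟙 _)
    (τU : U'' ⟶ U) (hτU : IsBlowup τU sU.ker) (w : U'') : GoodAt (τU ≫ rU) w := by
  -- `U` is locally Noetherian and regular; the centre `V(ker s_U) ≅ Spec O` is regular
  haveI : IsLocallyNoetherian U := LocallyOfFiniteType.isLocallyNoetherian rU
  haveI : IsRegularRing (CommRingCat.of O) := inferInstanceAs (IsRegularRing O)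
  have hUreg : Scheme.IsRegular U := Scheme.IsRegular.of_smooth rU (Scheme.isRegular_Spec (.of O))
  obtain ⟨_, hZreg, hclz, -⟩ := section_isClosedImmersion_and_isRegular_ker O U rU sU hsec
  -- (1) `U''` is regular (Liu 8.1.19 (a))
  have hU''reg : Scheme.IsRegular U'' := hτU.isRegular_of_isRegular_subscheme hUreg hZreg
  -- (2) the germ at `w` of a uniformizer is non-zero
  have hne : ∀ ϖ : O, Irreducible ϖ → (U''.presheaf.Γgerm w).hom
      ((τU ≫ rU).appTop.hom ((Scheme.ΓSpecIso (CommRingCat.of O)).inv.hom ϖ)) ≠ 0 := by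
    intro ϖ hϖ h0
    apply (stub_goodAtOfSmooth O U rU ‹_› (τU w)).2 ϖ hϖ
    have h1 : (τU.stalkMap w).hom ((U.presheaf.Γgerm (τU w)).hom
        (rU.appTop.hom ((Scheme.ΓSpecIso (CommRingCat.of O)).inv.hom ϖ))) = 0 := by
      rw [stalkMap_Γgerm_apply', ← h0, Scheme.Hom.comp_appTop, CommRingCat.hom_comp,
        RingHom.comp_apply]
    rw [hτU.stalkMap_injective w (h1.trans (map_zero _).symm)]
    exact Ideal.zero_mem _
  -- (3) the special fibre `U'' ×_{Spec O} Spec κ ≅ U'' ×_U U_κ` is regular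
  haveI : IsClosedImmersion (Spec.map (CommRingCat.ofHom (residue O))) :=
    IsClosedImmersion.spec_of_surjective _ residue_surjective
  haveI : IsReduced ↑(pullback rU (Spec.map (CommRingCat.ofHom (residue O)))) :=
    isReduced_of_smooth (pullback.snd rU (Spec.map (CommRingCat.ofHom (residue O))))
  haveI : IsLocallyNoetherian ↑(pullback rU (Spec.map (CommRingCat.ofHom (residue O)))) :=
    LocallyOfFiniteType.isLocallyNoetherian
      (pullback.snd rU (Spec.map (CommRingCat.ofHom (residue O))))
  have hκ : ∀ y : ↥(Spec (.of (ResidueField O))),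
      Spec.map (CommRingCat.ofHom (residue O)) y = closedPoint O := fun y =>
    IsLocalRing.PrimeSpectrum.comap_residue O y
  -- `U_κ` lies over the closed point
  have hrange : Set.range ⇑(pullback.fst rU (Spec.map (CommRingCat.ofHom (residue O))) ≫ rU) ⊆
      {closedPoint O} := by
    rintro _ ⟨z, rfl⟩
    show (pullback.fst rU (Spec.map (CommRingCat.ofHom (residue O))) ≫ rU) z = closedPoint O
    rw [pullback.condition, Scheme.Hom.comp_apply]
    exact hκ _
  -- the point `z₁'` of `U_κ` over `z₁ = s_U(𝔪)`; it is closed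
  have hrz₁ : rU (sU (closedPoint O)) =
      Spec.map (CommRingCat.ofHom (residue O)) (closedPoint (ResidueField O)) := by
    rw [hκ, ← Scheme.Hom.comp_apply, hsec]
    rfl
  obtain ⟨z₁', hz₁', -⟩ := Scheme.Pullback.exists_preimage_pullback (f := rU)
    (g := Spec.map (CommRingCat.ofHom (residue O))) (sU (closedPoint O))
    (closedPoint (ResidueField O)) hrz₁
  have hcl : IsClosed ({z₁'} : Set ↥(pullback rU (Spec.map (CommRingCat.ofHom (residue O))))) := by
    have heq : ({z₁'} : Set ↥(pullback rU (Spec.map (CommRingCat.ofHom (residue O))))) =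
        (pullback.fst rU (Spec.map (CommRingCat.ofHom (residue O)))) ⁻¹' {sU (closedPoint O)} := by
      ext z
      simp only [Set.mem_singleton_iff, Set.mem_preimage]
      refine ⟨fun h => h ▸ hz₁', fun h => ?_⟩
      exact (pullback.fst rU _).isClosedEmbedding.injective (h.trans hz₁'.symm)
    rw [heq]
    exact hclz.preimage (pullback.fst rU _).continuous
  -- the centre of the base-changed blow-up is the reduced closed point `z₁'`
  have hK := ker_section_comap_eq_vanishingIdeal O U _ rU sU hsec
    (pullback.fst rU (Spec.map (CommRingCat.ofHom (residue O)))) hrange z₁' hz₁' hcl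
  have hflat := flat_exceptional_of_isBlowup_section O U U'' rU sU hsec τU hτU
  have hBs := isBlowup_specialFibre_of_flat_exceptional O U U'' rU sU τU hτU hflat
  rw [hK] at hBs
  -- `U_κ` is regular (smooth over a field), hence so is its blow-up in the reduced point `z₁'`
  have hUκreg : Scheme.IsRegular ↑(pullback rU (Spec.map (CommRingCat.ofHom (residue O)))) :=
    fun z => isRegularLocalRing_stalk_of_smooth_of_field
      (pullback.snd rU (Spec.map (CommRingCat.ofHom (residue O)))) z
  have hfibreg := hBs.isRegular_of_isRegular_subscheme hUκreg
    (isRegular_subscheme_vanishingIdeal_singleton z₁' hcl)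
  have hfib : Scheme.IsRegular
      ↑(pullback (τU ≫ rU) (Spec.map (CommRingCat.ofHom (residue O)))) :=
    Scheme.IsRegular.of_isOpenImmersion
      (pullbackRightPullbackFstIso rU (Spec.map (CommRingCat.ofHom (residue O))) τU).inv hfibreg
  -- (4) assemble
  exact goodAt_of_isRegularLocalRing_fibre O U'' (τU ≫ rU) w (hU''reg w) hne (fun z _ => hfib z)

/-! ## The registered helper -/

/-- **`goodAt_of_isBlowup_section`.** Let `O` be a discrete valuation ring, `X'` integral and
separated over `Spec O`, `U ⊆ X'` an open smooth over `Spec O`, `s` a section of `X' → Spec O`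
with `s(𝔪) ∈ U`, and `τ : X'' → X'` a blow-up along `ker s`. Then the blown-up ambient has good
reduction at every `w ∈ X''` over `s(𝔪)`: `𝒪_{X'',w}` is regular and the germ of a uniformizer is
a regular parameter there. Reduction to `goodAt_of_isBlowup_section_local`: `s` factors through
`U` (every point of `Spec O` specializes to the closed point and `U` is open), `ker s|_U = ker s_U`,
the blow-up restricts over `U` to a blow-up of `U` along `ker s_U` (`IsBlowup.restrict`), and good
reduction is unchanged along the open immersion `τ⁻¹(U) ↪ X''` (`stub_goodAtOverIso`).
[cite: Liu2002, Thm. 8.1.19] -/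
theorem goodAt_of_isBlowup_section : ∀ (O : Type) [CommRing O] [IsDomain O] [IsDiscreteValuationRing O] (X' X'' : AlgebraicGeometry.Scheme.{0}) [AlgebraicGeometry.IsIntegral X'] (r' : X' ⟶ AlgebraicGeometry.Spec (.of O)) [AlgebraicGeometry.IsSeparated r'] (U : X'.Opens), AlgebraicGeometry.Smooth (CategoryTheory.CategoryStruct.comp U.ι r') → ∀ (s : AlgebraicGeometry.Spec (.of O) ⟶ X'), CategoryTheory.CategoryStruct.comp s r' = CategoryTheory.CategoryStruct.id _ → s (IsLocalRing.closedPoint O) ∈ U → ∀ (τ : X'' ⟶ X'), Literature.AlgebraicGeometry.Resolution.IsBlowup τ s.ker → ∀ w : X'', τ w = s (IsLocalRing.closedPoint O) → Summit.ResolutionOfSingularities.ResolutionOfSingularities.Theses.EquisingularLift.Split.GoodAt (CategoryTheory.CategoryStruct.comp τ r') w := by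
  intro O _ _ _ X' X'' _ r' _ U hsm s hs hsU τ hτ w hw
  -- the section `s` of the separated `r'` is a closed immersion
  haveI : IsClosedImmersion s :=
    haveI : IsClosedImmersion (s ≫ r') := by rw [hs]; infer_instance
    .of_comp s r'
  -- (0) `s` factors through the open `U ∋ s(𝔪)`: opens are stable under generization
  have hrange : Set.range s ⊆ Set.range U.ι := by
    rw [Scheme.Opens.range_ι]
    rintro _ ⟨t, rfl⟩
    exact ((specializes_closedPoint t).map s.continuous).mem_open U.2 hsU
  have hfac : IsOpenImmersion.lift U.ι s hrange ≫ U.ι = s := IsOpenImmersion.lift_fac _ _ _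
  haveI : Smooth (U.ι ≫ r') := hsm
  have hsec : IsOpenImmersion.lift U.ι s hrange ≫ U.ι ≫ r' = 𝟙 _ := by
    rw [← Category.assoc, hfac, hs]
  haveI : Nonempty (U : Scheme.{0}) := ⟨⟨_, hsU⟩⟩
  haveI : IsIntegral (U : Scheme.{0}) := isIntegral_of_isOpenImmersion U.ι
  -- the blow-up restricted over `U` is a blow-up of `U` along `ker s_U`
  have hτU : IsBlowup (τ ∣_ U) (IsOpenImmersion.lift U.ι s hrange).ker := by
    rw [← ker_comap_ι_eq_ker_lift s U hrange]
    exact hτ.restrict U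
  -- the point `w` lies in `τ⁻¹(U)`
  have hwU : w ∈ τ ⁻¹ᵁ U := by
    show τ w ∈ U
    rw [hw]
    exact hsU
  -- the local statement on `τ⁻¹(U) → U → Spec O`
  have hgood := goodAt_of_isBlowup_section_local O U _ (U.ι ≫ r')
    (IsOpenImmersion.lift U.ι s hrange) hsec (τ ∣_ U) hτU ⟨w, hwU⟩
  -- move to `X''` along the open immersion `τ⁻¹(U) ↪ X''`
  haveI := isIso_ι_morphismRestrict_self (τ ⁻¹ᵁ U)
  have key := stub_goodAtOverIso X'' _ (τ ⁻¹ᵁ U).ι (τ ⁻¹ᵁ U) inferInstance ⟨w, hwU⟩ w rfl hwU O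
    (τ ≫ r')
  rw [← morphismRestrict_ι_assoc] at key
  exact key.mp hgood

end Summit.ResolutionOfSingularities.ResolutionOfSingularities.Cruxes.EquisingularLift.StrataSplit

end
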